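import Literature.IUT.HodgeTheaters.PuncturedEllipticProLModelCusps
import Mathlib.Algebra.BigOperators.Pi
import HarnessLib

/-!
# An infinite pro-`l` model of [IUTchI] §1, part 4: `[Δ_X : Ker(Δ_X ↠ Δ_X^{ab} ⊗ ℤ/l)] = l²` and the classical laws

Mochizuki, *Inter-universal Teichmüller theory I*, kurims manuscript (May 2020), §1 pp. 37–39
([IUTchI] §1 p.37) [claim: Mochizuki2012, status: disputed] (D-0012 claim key; series status DISPUTED —
WITNESS-class PROOF-ONLY module; nothing of the series is asserted, no side is taken on [IUTchIII] Cor. 3.12).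

At the pro-`l` datum `ProLModel.datum l h5` (parts 1–3, abc-iut-L5-d4: `Π_C = ℤ_l^{ℤ/l} ⋊ (ℤ_l ⋊ ℤ/2)`,
`Δ_X = Π_X = N ⋊ ⟨a⟩`, `Δ_X̲ = N ⋊ ⟨a^l⟩`, cusps `ℤ/l` with `I_i = ℤ_l · c_i`), the CLASSICAL-LAW binders of the
Layer-5 certificate row `layer5_held_cor12_v6` ([IUTchI] Cor. 1.2 at the genuine datum; abc-iut-L5-d4 closer,
abc-iut-L5-d1 certificate) that concern `H := Ker(Δ_X ↠ Δ_X^{ab} ⊗ ℤ/l)` — the closure of `[Δ_X, Δ_X] · Δ_X^l` —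
hold, in the LITERAL shapes of that row:
* `mem_frattini_iff` — `H = {(v, a^s) ∈ Π_X : Σ_m v_m ≡ 0, s ≡ 0 (mod l)}` (the commutators
  `[a^k, (w)] = (r_k w − w)` exhaust the sum-zero vectors; `l`-th powers give `l·N` and `a^{lℤ_l}`);
* **`frattini_relIndex` — `hrank`: `[Δ_X : H] = l²`** (`Δ_X/H ≅ ℤ/l × ℤ/l` via `(Σ_m v_m, s) mod l`; at every
  finite-geometric-part model of §1 this index is `l³` — the dead end recorded by abc-iut-L5-d4 g9, RETIRED here
  at an infinite datum carrying `CuspGalois`);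
* `inertia_le_frattini` — `hIH`: every cusp inertia group lies in `H` (`c_i = r_1 B_i − B_i` is a commutator);
* `not_deltaXbar_le_frattini` — `hXH`: `Δ_X̲ ⊄ H` (`B_0 ∈ Δ_X̲` has coordinate sum `1`);
(`hΔ` = F-0240 `GeomTFG` — topological finite generation of `Δ_C` — is the sequel `PuncturedEllipticProLModelTFG`.)
HONEST LABEL: semi-synthetic model (`G_k = 1`) — consistency evidence for OUR typed binders only; Mathlib's
`IsMulTorsionFree Δ_X` (power-injectivity, the binder `htf`) FAILS here (`(v·a)^l = (v′·a)^l` whenever `v − v′`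
has sum zero) and is left to a unipotent refinement.  No `sorry`; symbolic prime `l`.
-/

noncomputable section

namespace Literature.IUT.HodgeTheaters

namespace PuncturedEllipticData

namespace ProLModel

open DihedralGroup _root_.Topology Literature.AnabelianGeometry.AbsoluteAnabelian
open scoped Pointwise commutatorElement

variable (l : ℕ) [Fact l.Prime]

/-! ### Small algebra in `P` -/

/-- `inN 0 = 1`. [claim: Mochizuki2012, status: disputed] -/
@[simp] theorem inN_zero : inN l 0 = 1 := by unfold inN; rw [ofAdd_zero, map_one]

/-- `inN (n • w) = (inN w)^n` for a natural number `n` cast into `ℤ_l`. [claim: Mochizuki2012, status: disputed] -/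
theorem inN_natCast_smul (n : ℕ) (w : V l) : inN l ((n : ℤ_[l]) • w) = inN l w ^ n := by
  unfold inN; rw [Nat.cast_smul_eq_nsmul, ofAdd_nsmul, map_pow]

/-- `inN (v − w) = inN v · (inN w)⁻¹`. [claim: Mochizuki2012, status: disputed] -/
theorem inN_sub (v w : V l) : inN l (v - w) = inN l v * (inN l w)⁻¹ := by
  unfold inN; rw [ofAdd_sub, div_eq_mul_inv, map_mul, map_inv]

/-- `a^{s+t} = a^s · a^t`. [claim: Mochizuki2012, status: disputed] -/
theorem elA_add (s t : ℤ_[l]) : elA l (s + t) = elA l s * elA l t := by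
  unfold elA; rw [ofAdd_add, map_mul, map_mul]

/-- Every element of `Π_X` is `(v) · a^s`. [claim: Mochizuki2012, status: disputed] -/
theorem decomp_of_mem_PiXm {g : P l} (hgX : g ∈ PiXm l) :
    g = inN l (Multiplicative.toAdd g.left) * elA l (Multiplicative.toAdd g.right.left) := by
  have hg1 : g.right.right = 1 := (mem_PiXm_iff l g).1 hgX
  refine SemidirectProduct.ext ?_ ?_
  · rw [SemidirectProduct.mul_left, inN_left, inN_right, map_one, MulAut.one_apply]
    change g.left = Multiplicative.ofAdd (Multiplicative.toAdd g.left) * 1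
    rw [mul_one, ofAdd_toAdd]
  · rw [SemidirectProduct.mul_right, inN_right, one_mul]
    change g.right = SemidirectProduct.inl (Multiplicative.ofAdd (Multiplicative.toAdd g.right.left))
    exact SemidirectProduct.ext (by rw [SemidirectProduct.left_inl, ofAdd_toAdd]) hg1

/-- `a^{n·t} = (a^t)^n`. [claim: Mochizuki2012, status: disputed] -/
theorem elA_nsmul (n : ℕ) (t : ℤ_[l]) : elA l ((n : ℤ_[l]) * t) = elA l t ^ n := by
  unfold elA; rw [← nsmul_eq_mul, ofAdd_nsmul, map_pow, map_pow]

/-- Reduction `ℤ_l → ℤ/l` is continuous (locally constant). [folklore] -/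
private theorem continuous_toZMod' : Continuous (PadicInt.toZMod : ℤ_[l] → ZMod l) := by
  refine continuous_of_continuousAt_zero (PadicInt.toZMod (p := l)) ?_
  rw [ContinuousAt, map_zero, nhds_discrete (ZMod l), Filter.tendsto_pure]
  filter_upwards [Metric.ball_mem_nhds (0 : ℤ_[l]) one_pos] with x hx
  rwa [Metric.mem_ball, dist_zero_right, ← PadicInt.mem_nonunits, ← IsLocalRing.mem_maximalIdeal,
    ← PadicInt.ker_toZMod, RingHom.mem_ker] at hx

/-- `x ≡ 0 (mod l)` in `ℤ_l` means `x = l·t`. [folklore] -/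
private theorem exists_eq_mul_of_toZMod_eq_zero {x : ℤ_[l]} (hx : PadicInt.toZMod x = 0) :
    ∃ t : ℤ_[l], x = l * t := by
  have hx' : x ∈ RingHom.ker (PadicInt.toZMod (p := l)) := hx
  rw [PadicInt.ker_toZMod, PadicInt.maximalIdeal_eq_span_p, Ideal.mem_span_singleton'] at hx'
  obtain ⟨t, ht⟩ := hx'
  exact ⟨t, by rw [← ht, mul_comm]⟩

/-! ### `Δ_X = Π_X` and its group law in the coordinates `(Σ_m v_m, s)` -/

/-- `Δ_X = Π_X ∩ Δ_C = Π_X` at the datum (`G_k = 1`). [claim: Mochizuki2012, status: disputed] -/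
theorem deltaX_eq (h5 : 5 ≤ l) : (datum l h5).PiX ⊓ (datum l h5).DeltaC = PiXm l := by
  change PiXm l ⊓ (ext l).geom = PiXm l
  rw [geom_eq_top, inf_top_eq]

/-- Rotations preserve the coordinate sum. [claim: Mochizuki2012, status: disputed] -/
theorem sum_rot (k : ZMod l) (v : V l) : ∑ m, rot l k v m = ∑ m, v m := by
  simp only [rot_apply]
  exact Fintype.sum_equiv (Equiv.subRight k) _ _ fun m => rfl

/-- The coordinate sum of the `N`-part is additive on `Π_X`. [claim: Mochizuki2012, status: disputed] -/
theorem sum_left_mul {g : P l} (hg : g ∈ PiXm l) (h : P l) :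
    ∑ m, Multiplicative.toAdd (g * h).left m =
      ∑ m, Multiplicative.toAdd g.left m + ∑ m, Multiplicative.toAdd h.left m := by
  rw [SemidirectProduct.mul_left, toAdd_mul]
  simp only [Pi.add_apply]
  rw [Finset.sum_add_distrib, toAdd_phi_apply, toDih_right_of_mem_PiXm l hg, dact_r, sum_rot]

/-- The `⟨a⟩`-coordinate is multiplicative on `Π_X`. [claim: Mochizuki2012, status: disputed] -/
theorem right_left_mul {g : P l} (hg : g ∈ PiXm l) (h : P l) :
    (g * h).right.left = g.right.left * h.right.left := by
  rw [SemidirectProduct.mul_right, SemidirectProduct.mul_left, (mem_PiXm_iff l g).1 hg, map_one,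
    MulAut.one_apply]

/-- The coordinates `(Σ_m v_m, s) mod l` of an element of `P`. [claim: Mochizuki2012, status: disputed] -/
theorem coords_continuous : Continuous fun g : P l =>
    (PadicInt.toZMod (∑ m, Multiplicative.toAdd g.left m), PadicInt.toZMod (Multiplicative.toAdd g.right.left)) := by
  refine ((continuous_toZMod' l).comp ?_).prodMk ((continuous_toZMod' l).comp ?_)
  · exact continuous_finsetSum _ fun m _ =>
      (continuous_apply m).comp (continuous_toAdd.comp (continuous_left_right_P l).1)
  · exact continuous_toAdd.comp
      ((Literature.AnabelianGeometry.EtaleTheta.SettingModel.Semidirect.continuous_left (isInducing_D l)).comp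
        (continuous_left_right_P l).2)

/-- `[a^k, (w)] = (r_{k} w − w)`: rotation-commutators are coordinate differences. [claim: Mochizuki2012, status: disputed] -/
theorem commutator_elA_inN (k : ℤ_[l]) (w : V l) :
    ⁅elA l k, inN l w⁆ = inN l (rot l (PadicInt.toZMod k) w - w) := by
  rw [commutatorElement_def, inN_sub, conj_inN, toDih_right_of_mem_PiXm l (elA_mem_PiXm l k), dact_r]
  rfl

/-- `(v − (Σ_m v_m)·B_0) ∈ [Π_X, Π_X]` for every `v` (`B_i − B_0 = r_i B_0 − B_0` is a commutator).
[claim: Mochizuki2012, status: disputed] -/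
theorem inN_sub_sum_mem_commutator (v : V l) :
    inN l (v - (∑ m, v m) • δ l 0) ∈ ⁅PiXm l, PiXm l⁆ := by
  classical
  induction v using Pi.single_induction with
  | zero => simp only [Pi.zero_apply, Finset.sum_const_zero, zero_smul, sub_zero, inN_zero]; exact one_mem _
  | add f g hf hg =>
    have : f + g - (∑ m, (f + g) m) • δ l 0 = (f - (∑ m, f m) • δ l 0) + (g - (∑ m, g m) • δ l 0) := by
      simp only [Pi.add_apply, Finset.sum_add_distrib, add_smul]; abel
    rw [this, inN_add]
    exact mul_mem hf hg
  | single i t =>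
    have hsum : ∑ m, (Pi.single i t : V l) m = t := by
      rw [Finset.sum_eq_single i (fun m _ hm => Pi.single_eq_of_ne hm _)
        (fun h => absurd (Finset.mem_univ i) h), Pi.single_eq_same]
    have hrot : (Pi.single i t : V l) - t • δ l 0 =
        rot l (PadicInt.toZMod ((i.val : ℕ) : ℤ_[l])) (t • δ l 0) - t • δ l 0 := by
      congr 1
      funext m
      simp only [rot_apply, map_natCast, ZMod.natCast_zmod_val, Pi.smul_apply, δ_apply, Pi.single_apply,
        sub_eq_zero, smul_eq_mul, mul_ite, mul_one, mul_zero]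
    rw [hsum, hrot, ← commutator_elA_inN]
    exact Subgroup.commutator_mem_commutator (elA_mem_PiXm l _) (Nhat_le l (inN_mem_Nhat l _)).1

/-! ### `H = Ker(Δ_X ↠ Δ_X^{ab} ⊗ ℤ/l)` computed -/

/-- In `ℤ/l` (written multiplicatively) every `l`-th power is trivial. [folklore] -/
private theorem pow_l_eq_one (x : Multiplicative (ZMod l)) : x ^ l = 1 := by
  rw [← ofAdd_toAdd x, ← ofAdd_nsmul, nsmul_eq_mul, ZMod.natCast_self, zero_mul, ofAdd_zero]

/-- `H ⊆ {Σ ≡ 0, s ≡ 0}`: commutators and `l`-th powers of `Π_X` die under the continuous homomorphism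
`(Σ_m v_m, s) mod l : Π_X → ℤ/l × ℤ/l`, whose kernel is closed. [claim: Mochizuki2012, status: disputed] -/
theorem frattini_le {g : P l}
    (hg : g ∈ (⁅PiXm l, PiXm l⁆ ⊔ Subgroup.closure ((fun y : P l => y ^ l) '' (PiXm l : Set (P l)))).topologicalClosure) :
    g ∈ PiXm l ∧ PadicInt.toZMod (∑ m, Multiplicative.toAdd g.left m) = 0 ∧
      PadicInt.toZMod (Multiplicative.toAdd g.right.left) = 0 := by
  classical
  -- the homomorphism `Π_X → ℤ/l × ℤ/l`
  let f₁ : PiXm l →* Multiplicative (ZMod l) := MonoidHom.mk'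
    (fun g => Multiplicative.ofAdd (PadicInt.toZMod (∑ m, Multiplicative.toAdd g.1.left m)))
    (fun g h => by rw [← ofAdd_add, Subgroup.coe_mul, sum_left_mul l g.2, map_add])
  let f₂ : PiXm l →* Multiplicative (ZMod l) := MonoidHom.mk'
    (fun g => Multiplicative.ofAdd (PadicInt.toZMod (Multiplicative.toAdd g.1.right.left)))
    (fun g h => by rw [← ofAdd_add, Subgroup.coe_mul, right_left_mul l g.2, toAdd_mul, map_add])
  let f : PiXm l →* Multiplicative (ZMod l) × Multiplicative (ZMod l) := f₁.prod f₂
  let K : Subgroup (P l) := f.ker.map (PiXm l).subtype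
  have hKmem : ∀ x, x ∈ K ↔ ∃ hx : x ∈ PiXm l, f ⟨x, hx⟩ = 1 := fun x => by
    constructor
    · rintro ⟨y, hy, rfl⟩; exact ⟨y.2, hy⟩
    · rintro ⟨hx, h⟩; exact ⟨⟨x, hx⟩, h, rfl⟩
  have hf1 : ∀ (x : P l) (hx : x ∈ PiXm l), f ⟨x, hx⟩ = 1 ↔
      PadicInt.toZMod (∑ m, Multiplicative.toAdd x.left m) = 0 ∧
        PadicInt.toZMod (Multiplicative.toAdd x.right.left) = 0 := fun x hx => by
    rw [Prod.ext_iff]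
    exact Iff.rfl
  -- `K` is closed
  have hKclosed : IsClosed (K : Set (P l)) := by
    have hK : (K : Set (P l)) = (PiXm l : Set (P l)) ∩ (fun g : P l =>
        (PadicInt.toZMod (∑ m, Multiplicative.toAdd g.left m),
          PadicInt.toZMod (Multiplicative.toAdd g.right.left))) ⁻¹' {(0, 0)} := by
      ext x
      rw [SetLike.mem_coe, hKmem]
      constructor
      · rintro ⟨hx, h⟩; exact ⟨hx, Prod.ext ((hf1 x hx).1 h).1 ((hf1 x hx).1 h).2⟩
      · rintro ⟨hx, h⟩; exact ⟨hx, (hf1 x hx).2 ⟨congrArg Prod.fst h, congrArg Prod.snd h⟩⟩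
    rw [hK]
    exact ((PiXm l).isClosed_of_isOpen (isOpen_PiXm l)).inter
      ((isClosed_discrete _).preimage (coords_continuous l))
  -- `H ≤ K`
  have hle : (⁅PiXm l, PiXm l⁆ ⊔ Subgroup.closure ((fun y : P l => y ^ l) '' (PiXm l : Set (P l)))).topologicalClosure
      ≤ K := by
    refine Subgroup.topologicalClosure_minimal _ (sup_le ?_ ?_) hKclosed
    · rw [Subgroup.commutator_le]
      intro g hg h hh
      refine (hKmem _).2 ⟨(PiXm l).mul_mem ((PiXm l).mul_mem ((PiXm l).mul_mem hg hh) ((PiXm l).inv_mem hg))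
        ((PiXm l).inv_mem hh), ?_⟩
      change f ⁅(⟨g, hg⟩ : PiXm l), ⟨h, hh⟩⁆ = 1
      rw [map_commutatorElement, commutatorElement_eq_one_iff_mul_comm, mul_comm]
    · rw [Subgroup.closure_le]
      rintro _ ⟨y, hy, rfl⟩
      refine (hKmem _).2 ⟨(PiXm l).pow_mem hy l, ?_⟩
      have : (⟨y ^ l, (PiXm l).pow_mem hy l⟩ : PiXm l) = (⟨y, hy⟩ : PiXm l) ^ l := rfl
      rw [this, map_pow]
      exact Prod.ext (pow_l_eq_one l _) (pow_l_eq_one l _)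
  obtain ⟨hgX, hf⟩ := (hKmem g).1 (hle hg)
  exact ⟨hgX, (hf1 g hgX).1 hf⟩

/-- `{Σ ≡ 0, s ≡ 0} ⊆ H`: `(v, a^s) = (v − Σv·B_0) · (t·B_0)^l · (a^{t′})^l` with `Σ v = l t`, `s = l t′`.
[claim: Mochizuki2012, status: disputed] -/
theorem le_frattini {g : P l} (hgX : g ∈ PiXm l)
    (h1 : PadicInt.toZMod (∑ m, Multiplicative.toAdd g.left m) = 0)
    (h2 : PadicInt.toZMod (Multiplicative.toAdd g.right.left) = 0) :
    g ∈ (⁅PiXm l, PiXm l⁆ ⊔ Subgroup.closure ((fun y : P l => y ^ l) '' (PiXm l : Set (P l)))).topologicalClosure := by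
  obtain ⟨t, ht⟩ := exists_eq_mul_of_toZMod_eq_zero l h1
  obtain ⟨t', ht'⟩ := exists_eq_mul_of_toZMod_eq_zero l h2
  have hdec := decomp_of_mem_PiXm l hgX
  set v : V l := Multiplicative.toAdd g.left with hv
  set s : ℤ_[l] := Multiplicative.toAdd g.right.left with hs
  refine Subgroup.le_topologicalClosure _ ?_
  rw [hdec, ht']
  have hv' : v = (v - (∑ m, v m) • δ l 0) + (l : ℤ_[l]) • (t • δ l 0) := by
    rw [smul_smul, ← ht, sub_add_cancel]
  rw [hv', inN_add, inN_natCast_smul, elA_nsmul, mul_assoc]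
  refine mul_mem (Subgroup.mem_sup_left (inN_sub_sum_mem_commutator l v)) (Subgroup.mem_sup_right ?_)
  exact mul_mem (Subgroup.subset_closure ⟨inN l (t • δ l 0), (Nhat_le l (inN_mem_Nhat l _)).1, rfl⟩)
    (Subgroup.subset_closure ⟨elA l t', elA_mem_PiXm l t', rfl⟩)

/-- **`H = {(v, a^s) ∈ Π_X : Σ_m v_m ≡ 0, s ≡ 0 (mod l)}`** for `H := closure([Π_X, Π_X] · Π_X^l)`.
[claim: Mochizuki2012, status: disputed] -/
theorem mem_frattini_iff (g : P l) :
    g ∈ (⁅PiXm l, PiXm l⁆ ⊔ Subgroup.closure ((fun y : P l => y ^ l) '' (PiXm l : Set (P l)))).topologicalClosure ↔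
      g ∈ PiXm l ∧ PadicInt.toZMod (∑ m, Multiplicative.toAdd g.left m) = 0 ∧
        PadicInt.toZMod (Multiplicative.toAdd g.right.left) = 0 :=
  ⟨frattini_le l, fun h => le_frattini l h.1 h.2.1 h.2.2⟩

/-! ### The laws at the datum, in the literal shapes of `layer5_held_cor12_v6` -/

/-- The `H` of the datum (literal telescope shape, `Set`-level intersection included) is the `H` of `Π_X`.
[claim: Mochizuki2012, status: disputed] -/
theorem frattini_datum_eq (h5 : 5 ≤ l) :
    (⁅(datum l h5).PiX ⊓ (datum l h5).DeltaC, (datum l h5).PiX ⊓ (datum l h5).DeltaC⁆ ⊔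
        Subgroup.closure ((fun y : (datum l h5).PiC => y ^ (datum l h5).l) ''
          ((datum l h5).PiX ⊓ (datum l h5).DeltaC : Set (datum l h5).PiC))).topologicalClosure =
      (⁅PiXm l, PiXm l⁆ ⊔ Subgroup.closure ((fun y : P l => y ^ l) '' (PiXm l : Set (P l)))).topologicalClosure := by
  change (⁅PiXm l ⊓ (ext l).geom, PiXm l ⊓ (ext l).geom⁆ ⊔ Subgroup.closure ((fun y : P l => y ^ l) ''
    ((PiXm l : Set (P l)) ⊓ ((ext l).geom : Set (P l))))).topologicalClosure = _
  rw [geom_eq_top, inf_top_eq, Subgroup.coe_top, ← Set.top_eq_univ, inf_top_eq]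

/-- **`hrank` at the pro-`l` datum: `[Δ_X : Ker(Δ_X ↠ Δ_X^{ab} ⊗ ℤ/l)] = l²`** (literal shape of the binder
`hrank′` of `layer5_held_cor12_v6`, with `D′ := datum l h5`). [claim: Mochizuki2012, status: disputed] -/
theorem frattini_relIndex (h5 : 5 ≤ l) :
    (⁅(datum l h5).PiX ⊓ (datum l h5).DeltaC, (datum l h5).PiX ⊓ (datum l h5).DeltaC⁆ ⊔
        Subgroup.closure ((fun y : (datum l h5).PiC => y ^ (datum l h5).l) ''
          ((datum l h5).PiX ⊓ (datum l h5).DeltaC : Set (datum l h5).PiC))).topologicalClosure.relIndex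
        ((datum l h5).PiX ⊓ (datum l h5).DeltaC) = (datum l h5).l ^ 2 := by
  classical
  rw [frattini_datum_eq, deltaX_eq]
  change (⁅PiXm l, PiXm l⁆ ⊔ Subgroup.closure ((fun y : P l => y ^ l) '' (PiXm l : Set (P l)))).topologicalClosure.relIndex
    (PiXm l) = l ^ 2
  haveI : Fact (1 < l) := ⟨(Fact.out : l.Prime).one_lt⟩
  let f₁ : PiXm l →* Multiplicative (ZMod l) := MonoidHom.mk'
    (fun g => Multiplicative.ofAdd (PadicInt.toZMod (∑ m, Multiplicative.toAdd g.1.left m)))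
    (fun g h => by rw [← ofAdd_add, Subgroup.coe_mul, sum_left_mul l g.2, map_add])
  let f₂ : PiXm l →* Multiplicative (ZMod l) := MonoidHom.mk'
    (fun g => Multiplicative.ofAdd (PadicInt.toZMod (Multiplicative.toAdd g.1.right.left)))
    (fun g h => by rw [← ofAdd_add, Subgroup.coe_mul, right_left_mul l g.2, toAdd_mul, map_add])
  let f : PiXm l →* Multiplicative (ZMod l) × Multiplicative (ZMod l) := f₁.prod f₂
  have hker : f.ker = (⁅PiXm l, PiXm l⁆ ⊔ Subgroup.closure ((fun y : P l => y ^ l) ''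
      (PiXm l : Set (P l)))).topologicalClosure.subgroupOf (PiXm l) := by
    ext x
    rw [MonoidHom.mem_ker, Subgroup.mem_subgroupOf, mem_frattini_iff, Prod.ext_iff]
    exact ⟨fun h => ⟨x.2, h.1, h.2⟩, fun h => ⟨h.2.1, h.2.2⟩⟩
  have hsurj : Function.Surjective f := by
    rintro ⟨p, q⟩
    have hX : inN l (((Multiplicative.toAdd p).val : ℤ_[l]) • δ l 0) ∈ PiXm l := (Nhat_le l (inN_mem_Nhat l _)).1
    refine ⟨⟨inN l (((Multiplicative.toAdd p).val : ℤ_[l]) • δ l 0) * elA l ((Multiplicative.toAdd q).val : ℤ_[l]),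
      (PiXm l).mul_mem hX (elA_mem_PiXm l _)⟩, Prod.ext ?_ ?_⟩
    · change Multiplicative.ofAdd (PadicInt.toZMod (∑ m, Multiplicative.toAdd
        (inN l (((Multiplicative.toAdd p).val : ℤ_[l]) • δ l 0) * elA l _).left m)) = p
      rw [sum_left_mul l hX]
      have e1 : ∑ m, Multiplicative.toAdd (inN l (((Multiplicative.toAdd p).val : ℤ_[l]) • δ l 0)).left m =
          ((Multiplicative.toAdd p).val : ℤ_[l]) := by
        rw [inN_left, toAdd_ofAdd, Finset.sum_eq_single (0 : ZMod l) (fun m _ hm => by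
          rw [Pi.smul_apply, δ_apply, if_neg hm, smul_zero]) (fun h => absurd (Finset.mem_univ _) h),
          Pi.smul_apply, δ_apply, if_pos rfl, smul_eq_mul, mul_one]
      have e2 : ∑ m, Multiplicative.toAdd (elA l ((Multiplicative.toAdd q).val : ℤ_[l])).left m = 0 := by
        change ∑ m, Multiplicative.toAdd (1 : N l) m = 0
        simp only [toAdd_one, Pi.zero_apply, Finset.sum_const_zero]
      rw [e1, e2, add_zero, map_natCast, ZMod.natCast_zmod_val, ofAdd_toAdd]
    · change Multiplicative.ofAdd (PadicInt.toZMod (Multiplicative.toAdd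
        (inN l (((Multiplicative.toAdd p).val : ℤ_[l]) • δ l 0) * elA l _).right.left)) = q
      rw [right_left_mul l hX, inN_right]
      change Multiplicative.ofAdd (PadicInt.toZMod (Multiplicative.toAdd ((1 : C l) *
        Multiplicative.ofAdd ((Multiplicative.toAdd q).val : ℤ_[l])))) = q
      rw [one_mul, toAdd_ofAdd, map_natCast, ZMod.natCast_zmod_val, ofAdd_toAdd]
  rw [Subgroup.relIndex, ← hker, Subgroup.index_ker, MonoidHom.range_eq_top.mpr hsurj, Subgroup.card_top,
    Nat.card_prod, Nat.card_eq_fintype_card, Fintype.card_multiplicative, ZMod.card, pow_two]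

/-- `t·c_x = r_1 (t·B_x) − t·B_x`. [claim: Mochizuki2012, status: disputed] -/
theorem smul_cvec_eq (t : ℤ_[l]) (x : ZMod l) :
    t • cvec l x = rot l (PadicInt.toZMod (1 : ℤ_[l])) (t • δ l x) - t • δ l x := by
  funext m
  simp only [map_one, Pi.sub_apply, rot_apply, Pi.smul_apply, cvec_apply, δ_apply, smul_eq_mul, mul_sub,
    sub_eq_iff_eq_add]

/-- **`hIH` at the pro-`l` datum: every cusp inertia group lies in `H`** (`t·c_i = [a, (t·B_i)]`; literal shape
of the binder `hIH′` of `layer5_held_cor12_v6`, `D′ := datum l h5`). [claim: Mochizuki2012, status: disputed] -/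
theorem inertia_le_frattini (h5 : 5 ≤ l) (x : (datum l h5).Cusp) :
    (datum l h5).inertia x ≤
      (⁅(datum l h5).PiX ⊓ (datum l h5).DeltaC, (datum l h5).PiX ⊓ (datum l h5).DeltaC⁆ ⊔
        Subgroup.closure ((fun y : (datum l h5).PiC => y ^ (datum l h5).l) ''
          ((datum l h5).PiX ⊓ (datum l h5).DeltaC : Set (datum l h5).PiC))).topologicalClosure := by
  rw [frattini_datum_eq]
  rintro g ⟨⟨s, rfl⟩, -⟩
  refine Subgroup.le_topologicalClosure _ (Subgroup.mem_sup_left ?_)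
  rw [inertiaHom_apply, smul_cvec_eq, ← commutator_elA_inN]
  exact Subgroup.commutator_mem_commutator (elA_mem_PiXm l _) (Nhat_le l (inN_mem_Nhat l _)).1

/-- `B_0 ∉ H` (coordinate sum `1 ≢ 0`), although `B_0 ∈ Δ_X̲`. [claim: Mochizuki2012, status: disputed] -/
theorem inN_δ_not_mem_frattini :
    inN l (δ l 0) ∉ (⁅PiXm l, PiXm l⁆ ⊔ Subgroup.closure ((fun y : P l => y ^ l) ''
      (PiXm l : Set (P l)))).topologicalClosure := by
  haveI : Fact (1 < l) := ⟨(Fact.out : l.Prime).one_lt⟩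
  intro h
  have h2 := (frattini_le l h).2.1
  rw [inN_left, toAdd_ofAdd, Finset.sum_eq_single (0 : ZMod l) (fun m _ hm => by rw [δ_apply, if_neg hm])
    (fun h => absurd (Finset.mem_univ _) h), δ_apply, if_pos rfl, map_one] at h2
  exact one_ne_zero h2

/-- **`hXH` at the pro-`l` datum: `Δ_X̲ ⊄ H`** (literal shape of the intermediate law `hXH′` of
`pe_characteristicNatureOfCoverings_viaX`, `D′ := datum l h5`). [claim: Mochizuki2012, status: disputed] -/
theorem not_deltaXbar_le_frattini (h5 : 5 ≤ l) :
    ¬ (datum l h5).DeltaXbar ≤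
      (⁅(datum l h5).PiX ⊓ (datum l h5).DeltaC, (datum l h5).PiX ⊓ (datum l h5).DeltaC⁆ ⊔
        Subgroup.closure ((fun y : (datum l h5).PiC => y ^ (datum l h5).l) ''
          ((datum l h5).PiX ⊓ (datum l h5).DeltaC : Set (datum l h5).PiC))).topologicalClosure := by
  rw [frattini_datum_eq]
  intro h
  refine inN_δ_not_mem_frattini l (h ⟨Nhat_le l (inN_mem_Nhat l _), ?_⟩)
  change inN l (δ l 0) ∈ (ext l).geom
  rw [geom_eq_top]; trivial

end ProLModel

end PuncturedEllipticData

end Literature.IUT.HodgeTheaters
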